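import Summits.BirchSwinnertonDyer.BirchSwinnertonDyer.Theses.QuadraticBranchSignedControl
import Summits.BirchSwinnertonDyer.BirchSwinnertonDyer.Theorems.QuadraticBranchSignedControlEtaLayerClassical
import Literature.NumberTheory.GaloisRepresentations.PadicAlgebraDegreeOnePlace
import Mathlib.NumberTheory.Padics.HeightOneSpectrum
import HarnessLib

/-!
# Route `QuadraticBranchSignedControl` (rung K8, cell `bsd-potss`): item `EtaLayerComparison`
# (stmt-BirchSwinnertonDyer-19583) — the layer-level local-conditions comparison `hLayer` of the
# crux `EtaTransportSigned` (stmt-BirchSwinnertonDyer-19115), PROVED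

WHAT. `EtaLayerComparison` (= the hypothesis `hLayer` of seat k8q-c3 g0's `selmerMap_of_layerMaps`,
ctrl's (i-c) at the finite layers): for `V/ℚ`, a `ℤ_p`-extension `κ` of `ℚ` onto on `Gal(ℚ̄/F)`,
a quadratic `F` (Galois, `Gal(ℚ̄/F)` normal in `Γ_ℚ`) and every layer `n`, the image of Kobayashi's
plus Selmer group `Sel⁺(V_F/F_n)` (Def. 1.1: classical conditions at the places of `F_n`, plus
condition at the places `𝔭 ∣ p` of `F` over `F_𝔭·F_n`; `Γ_F`-internal,
`Kobayashi2003.signedSelmerLayer (V.baseChange F) κ|_{Γ_F} 1 n`) under ctrl's base-change isomorphism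
`Θ_n = subgroupH1Iso ∘ res` EQUALS cc-typer-6's tower plus Selmer group `Sel⁺(V/Fℚ_n)`
(`towerSignedSelmerLayer V κ F ℚ_[p] 1 n`: classical conditions at the places of `ℚ`, plus condition
at the model `ℚ_p` over `ℚ_p·F·ℚ_n`; `Γ_ℚ`-internal). Proof = files 1–5 of the base-change package
(`…EtaLayerLocalTransport/SignedPoints/Kummer/Packages/Classical.lean`): the classical parts agree
(`map_subgroupH1Iso_selmerGroupOver`, every place of `F` / of `ℚ` is accounted for by place
factorisation), and the families of plus-Kummer conditions agree conjunct by conjunct along a local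
package at `p` (`subgroupH1Iso_mem_localKummerOverOfEmb_iff` with
`map_transportPoints_signedLocalPointsOfEmb_one`: Kobayashi's `E⁺(F_𝔭·F_n)` IS the tower plus group —
the same local field `ℚ_p·F·ℚ_n`, so the feared index-2 discrepancy at the ramified prime does not
arise), the model `ℚ_p ≃ ℚ_{(p)}` entering through Mathlib's `padicEquiv`.

HONEST FRAMING (cell `bsd-potss`, run/shared/lean/pub/bsd-potss/; FULL-BSD rank ≤ 1 programme):
this closes the SUPPORT LEAF 19583 of rung K8 («closes rung-internal item 19583 of
BirchSwinnertonDyer», the open mathematics of the crux 19115 as split by the planner; with the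
landed glue 19585 the crux `EtaTransportSigned` follows from the held published input
`PublishedInputThm74` = Kobayashi 2003 Thm. 7.4 at `η` ALONE). It is Galois-cohomology bookkeeping
(Serre II.§1.1); NOTHING about Kobayashi's theorems, (C1_η) or `BSD(W, p)` is claimed; BSD is not
proved by any of this; no label or count moves. No definition, no named fact, no `sorry`, axioms
standard. Seat `bsd-potss-k8q-c3` (prover), g2.

References: [Kobayashi2003] Def. 1.1 (p. 2), §2 p. 4, Def. 2.1 (p. 5); [GreenbergLNM1716] §2;
[SerreGaloisCohomology1997] II.§1.1; [NeukirchANT1999] II.§8.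
-/

set_option autoImplicit false
set_option linter.dupNamespace false

noncomputable section

open scoped Classical

open NumberField IsDedekindDomain
open Literature.NumberTheory.EllipticCurves
open Literature.NumberTheory.GaloisRepresentations
open Summit.BirchSwinnertonDyer.Rank1Residual.Additive
open Summit.BirchSwinnertonDyer.Rank1Residual.Additive.LocalTransport
open Summit.BirchSwinnertonDyer.Rank1Residual.Additive.BaseChange

namespace Summit.BirchSwinnertonDyer.BirchSwinnertonDyer.Theorems.EtaLayer

/-! ## §1 Restriction along an equality of subgroups -/

/-- **Kobayashi's `Sel^ε(E/L_n)` restricted along a subgroup EQUALITY `Gal(L̄/L_n) = H₂`** is the same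
expression at `H₂` (restriction along `le_refl` is the identity, `resOfLe_refl`).
[cite: Kobayashi2003, Def. 1.1 (p. 2)] -/
theorem map_resOfLe_signedSelmerLayer_eq {L' : Type} [Field L'] [NumberField L']
    (W' : WeierstrassCurve L') {p' : ℕ} [Fact p'.Prime] (κ' : ZpExtension L' p') (ε : ℤˣ)
    (n : ℕ) {H₂ : Subgroup (Field.absoluteGaloisGroup L')} [H₂.Normal] (e : κ'.layerSubgroup n = H₂) :
    (Kobayashi2003.signedSelmerLayer W' κ' ε n : AddSubgroup (W'.subgroupH1 p' (κ'.layerSubgroup n))).map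
        (W'.resOfLe p' e.ge) =
      W'.selmerGroupOver p' H₂ ⊓
        ⨅ (v : HeightOneSpectrum (𝓞 L')) (_ : (p' : 𝓞 L') ∈ v.asIdeal)
          (σ : Field.absoluteGaloisGroup L'),
          (Kobayashi2003.localKummerOverOfEmb W' p' H₂ (closureEmb (K := L') (v.adicCompletion L'))
              (Kobayashi2003.signedLocalPoints κ' (v.adicCompletion L') W' ε n)).comap
            (W'.conjH1 p' H₂ σ) := by
  subst e
  rw [show W'.resOfLe p' (le_refl (κ'.layerSubgroup n)) = AddMonoidHom.id _ from
    resOfLe_refl_holds (M := W'.geomPrimaryTorsion p') (κ'.layerSubgroup n), AddSubgroup.map_id]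
  rfl

/-! ## §2 The families of plus-Kummer conditions under `subgroupH1Iso` (`K = ℚ`, model `ℚ_p`) -/

/-- **The plus-Kummer conditions of `V_F` at the places `𝔭 ∣ p` of `F` (all `Γ_F`-conjugates) are
carried by `subgroupH1Iso` ONTO the plus-Kummer conditions of `V` at the model `ℚ_p` (all
`Γ_ℚ`-conjugates)**, layer `n` of the tower `U = towerSubgroup κ F`, `κF = κ|_{Γ_F}`. `⊆`: a
`Γ_ℚ`-conjugate of `ι_{ℚ_p}` factors through some `F_𝔭`, `𝔭 ∣ p` (package, file 4); along it the
Kummer condition is an iff (file 3) and the cutting groups correspond (file 2); the `F`-side conjunct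
at the resulting `Γ_F`-conjugate of `ι_{F_𝔭}` applies. `⊇`: symmetrically from an `F`-embedding
`L̄ → F̄_𝔭`, `𝔭 ∣ p` (its place of `ℚ` below is `(p)`). The model `ℚ_p` of `ℚ_{(p)}` is Mathlib's
`padicEquiv`. [cite: Kobayashi2003, Def. 1.1 (p. 2), §2 p. 4, Def. 2.1 (p. 5)] [cite: GreenbergLNM1716, §2] -/
theorem map_subgroupH1Iso_plusKummerConditions {p : ℕ} [Fact p.Prime] (V : WeierstrassCurve ℚ)
    (κ : ZpExtension ℚ p) (F : Type) [Field F] [NumberField F] [IsGalois ℚ F]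
    [(galRange (K := ℚ) F).Normal]
    (hκ₀ : ∀ x, ∃ g ∈ galRange (K := ℚ) F, κ g = x) (n : ℕ) :
    (⨅ (w : HeightOneSpectrum (𝓞 F)) (_ : (p : 𝓞 F) ∈ w.asIdeal) (σ : Field.absoluteGaloisGroup F),
        (Kobayashi2003.localKummerOverOfEmb (V.baseChange F) p (comapResGal F (towerSubgroup κ F n))
            (closureEmb (K := F) (w.adicCompletion F))
            (Kobayashi2003.signedLocalPoints (restrictGal F κ hκ₀) (w.adicCompletion F)
              (V.baseChange F) 1 n)).comap
          ((V.baseChange F).conjH1 p (comapResGal F (towerSubgroup κ F n)) σ)).map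
        (subgroupH1Iso F V p (towerSubgroup_le_galRange κ F n)).toAddMonoidHom =
      ⨅ (σ : Field.absoluteGaloisGroup ℚ),
        (Kobayashi2003.localKummerOverOfEmb V p (towerSubgroup κ F n) (closureEmb (K := ℚ) ℚ_[p])
            (towerSignedLocalPointsOfEmb (towerSubgroup κ F) (closureEmb (K := ℚ) ℚ_[p]) V 1 n)).comap
          (V.conjH1 p (towerSubgroup κ F n) σ) := by
  have hpP : p.Prime := Fact.out
  -- the place `v₀ = (p)` of `ℚ` and the model `ℚ_p` of `ℚ_{v₀}` (Mathlib `padicEquiv`)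
  obtain ⟨v₀, hv₀⟩ : ∃ v : HeightOneSpectrum (𝓞 ℚ), ((p : ℕ) : 𝓞 ℚ) ∈ v.asIdeal := by
    have hnu : ¬ IsUnit ((p : ℕ) : 𝓞 ℚ) := by
      intro h
      have h' := h.map Rat.ringOfIntegersEquiv
      rw [map_natCast, Int.isUnit_iff_natAbs_eq, Int.natAbs_natCast] at h'
      exact hpP.one_lt.ne' h'
    obtain ⟨M, hM, hle⟩ := Ideal.exists_le_maximal (Ideal.span {((p : ℕ) : 𝓞 ℚ)})
      (by rwa [Ne, Ideal.span_singleton_eq_top])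
    have hpM : ((p : ℕ) : 𝓞 ℚ) ∈ M := hle (Ideal.mem_span_singleton_self _)
    refine ⟨⟨M, hM.isPrime, fun hbot => ?_⟩, hpM⟩
    rw [hbot, Ideal.mem_bot] at hpM
    exact hpP.ne_zero (by exact_mod_cast hpM)
  have hpeq := LocalField.primesEquiv_eq_of_natCast_mem p v₀ hv₀
  subst hpeq
  set e : v₀.adicCompletion ℚ ≃+* ℚ_[((Rat.HeightOneSpectrum.primesEquiv v₀ : Nat.Primes) : ℕ)] :=
    (Rat.HeightOneSpectrum.adicCompletion.padicEquiv (R := 𝓞 ℚ) v₀).toRingEquiv with hedef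
  have he : ∀ x : ℚ, e (algebraMap ℚ (v₀.adicCompletion ℚ) x) =
      algebraMap ℚ ℚ_[((Rat.HeightOneSpectrum.primesEquiv v₀ : Nat.Primes) : ℕ)] x := fun x =>
    (Rat.HeightOneSpectrum.adicCompletion.padicEquiv (R := 𝓞 ℚ) v₀).toAlgEquiv.commutes x
  -- every place `w ∋ p` of `F` lies over `v₀`
  have hover : ∀ w : HeightOneSpectrum (𝓞 F),
      (((Rat.HeightOneSpectrum.primesEquiv v₀ : Nat.Primes) : ℕ) : 𝓞 F) ∈ w.asIdeal →
        w.asIdeal.LiesOver v₀.asIdeal := by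
    intro w hw
    have h1 := LocalField.natCast_mem_under ((Rat.HeightOneSpectrum.primesEquiv v₀ : Nat.Primes) : ℕ) w hw
    have h2 := LocalField.heightOneSpectrum_rat_eq_of_natCast_mem
      ((Rat.HeightOneSpectrum.primesEquiv v₀ : Nat.Primes) : ℕ) (w.under (𝓞 ℚ)) v₀ h1 hv₀
    rw [← h2]
    exact ⟨rfl⟩
  have hunder : ∀ w : HeightOneSpectrum (𝓞 F), w.asIdeal.LiesOver v₀.asIdeal →
      (((Rat.HeightOneSpectrum.primesEquiv v₀ : Nat.Primes) : ℕ) : 𝓞 F) ∈ w.asIdeal := by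
    intro w hw
    have h := hw.over
    have h3 : (((Rat.HeightOneSpectrum.primesEquiv v₀ : Nat.Primes) : ℕ) : 𝓞 ℚ) ∈
        w.asIdeal.comap (algebraMap (𝓞 ℚ) (𝓞 F)) := by
      rw [Ideal.under_def] at h
      rw [← h]; exact hv₀
    rw [Ideal.mem_comap, map_natCast] at h3
    exact h3
  -- notation
  set U := towerSubgroup κ F with hUdef
  have hU : ∀ m, U m ≤ galRange (K := ℚ) F := fun m => towerSubgroup_le_galRange κ F m
  set κF := restrictGal F κ hκ₀ with hκFdef
  have hκU : ∀ (m : ℕ) (τ : Field.absoluteGaloisGroup F),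
      τ ∈ κF.layerSubgroup m ↔ resGal (K := ℚ) F τ ∈ U m := fun m τ =>
    mem_layerSubgroup_restrictGal_iff F κ hκ₀ m τ
  set Θ := subgroupH1Iso F V (((Rat.HeightOneSpectrum.primesEquiv v₀ : Nat.Primes) : ℕ)) (hU n) with hΘdef
  -- `⊆`, at an arbitrary `ℚ`-embedding `ι : ℚ̄ → ℚ̄_p-bar`
  have key : ∀ (x : (V.baseChange F).subgroupH1 _ (comapResGal F (U n))),
      (∀ (w : HeightOneSpectrum (𝓞 F)), w.asIdeal.LiesOver v₀.asIdeal →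
        ∀ ι' : AlgebraicClosure F →ₐ[F] AlgebraicClosure (w.adicCompletion F),
          x ∈ Kobayashi2003.localKummerOverOfEmb (V.baseChange F) _ (comapResGal F (U n)) ι'
            (Kobayashi2003.signedLocalPointsOfEmb κF ι' (V.baseChange F) 1 n)) →
      ∀ ι : AlgebraicClosure ℚ →ₐ[ℚ]
          AlgebraicClosure ℚ_[((Rat.HeightOneSpectrum.primesEquiv v₀ : Nat.Primes) : ℕ)],
        Θ x ∈ Kobayashi2003.localKummerOverOfEmb V _ (U n) ι (towerSignedLocalPointsOfEmb U ι V 1 n) := by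
    intro x hx ι
    obtain ⟨w, hw, ι₂, ι', hcompat, hf, hfixL⟩ := exists_package_adicCompletion F v₀ e he ι
    rw [← map_transportPoints_signedLocalPointsOfEmb_one F ι ι₂ ι' hcompat
        ((adicCompletionMap (K := ℚ) F v₀ w).comp e.symm.toRingHom) hf hfixL V U hU κF hκU n,
      hΘdef, subgroupH1Iso_mem_localKummerOverOfEmb_iff F ι ι₂ ι' hcompat
        ((adicCompletionMap (K := ℚ) F v₀ w).comp e.symm.toRingHom) hf V _ (hU n) hfixL]
    exact hx w hw ι'
  -- `⊇`, at an arbitrary `F`-embedding `ι'₀ : F̄ → F̄_𝔭-bar`, `𝔭 ∣ p`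
  have key' : ∀ (y : V.subgroupH1 _ (U n)),
      (∀ ι : AlgebraicClosure ℚ →ₐ[ℚ]
          AlgebraicClosure ℚ_[((Rat.HeightOneSpectrum.primesEquiv v₀ : Nat.Primes) : ℕ)],
        y ∈ Kobayashi2003.localKummerOverOfEmb V _ (U n) ι (towerSignedLocalPointsOfEmb U ι V 1 n)) →
      ∀ (w : HeightOneSpectrum (𝓞 F)), w.asIdeal.LiesOver v₀.asIdeal →
        ∀ ι'₀ : AlgebraicClosure F →ₐ[F] AlgebraicClosure (w.adicCompletion F),
          Θ.symm y ∈ Kobayashi2003.localKummerOverOfEmb (V.baseChange F) _ (comapResGal F (U n)) ι'₀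
            (Kobayashi2003.signedLocalPointsOfEmb κF ι'₀ (V.baseChange F) 1 n) := by
    intro y hy w hw ι'₀
    haveI := hw
    obtain ⟨ι, ι₂, hcompat, hf, hfixL⟩ := exists_package_adicCompletion_of_embedding F v₀ e he w ι'₀
    rw [hΘdef, ← subgroupH1Iso_mem_localKummerOverOfEmb_iff F ι ι₂ ι'₀ hcompat
        ((adicCompletionMap (K := ℚ) F v₀ w).comp e.symm.toRingHom) hf V _ (hU n) hfixL,
      map_transportPoints_signedLocalPointsOfEmb_one F ι ι₂ ι'₀ hcompat
        ((adicCompletionMap (K := ℚ) F v₀ w).comp e.symm.toRingHom) hf hfixL V U hU κF hκU n,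
      AddEquiv.apply_symm_apply]
    exact hy ι
  ext y
  rw [AddSubgroup.mem_map]
  constructor
  · rintro ⟨x, hx, rfl⟩
    rw [AddSubgroup.mem_iInf]
    intro σ
    rw [AddSubgroup.mem_comap, conjH1_mem_localKummerOverOfEmb_iff,
      ← towerSignedLocalPointsOfEmb_comp U (closureEmb (K := ℚ) _) σ 1 n]
    refine key x (fun w hw ι' ↦ ?_) _
    obtain ⟨τ, rfl⟩ := exists_algHom_eq_comp (closureEmb (K := F) (w.adicCompletion F)) ι'
    rw [signedLocalPointsOfEmb_comp, ← conjH1_mem_localKummerOverOfEmb_iff]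
    rw [AddSubgroup.mem_iInf] at hx
    have hx' := hx w
    rw [AddSubgroup.mem_iInf] at hx'
    have hx'' := hx' (hunder w hw)
    rw [AddSubgroup.mem_iInf] at hx''
    exact hx'' _
  · intro hy
    refine ⟨Θ.symm y, ?_, Θ.apply_symm_apply y⟩
    rw [AddSubgroup.mem_iInf]
    intro w
    rw [AddSubgroup.mem_iInf]
    intro hw
    rw [AddSubgroup.mem_iInf]
    intro σ'
    rw [AddSubgroup.mem_comap, conjH1_mem_localKummerOverOfEmb_iff]
    change Θ.symm y ∈ Kobayashi2003.localKummerOverOfEmb (V.baseChange F) _ (comapResGal F (U n)) _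
      (Kobayashi2003.signedLocalPointsOfEmb κF (closureEmb (K := F) (w.adicCompletion F))
        (V.baseChange F) 1 n)
    rw [← signedLocalPointsOfEmb_comp κF (closureEmb (K := F) (w.adicCompletion F)) σ' 1 n]
    refine key' y (fun ι ↦ ?_) w (hover w hw) _
    obtain ⟨τ, rfl⟩ := exists_algHom_eq_comp
      (closureEmb (K := ℚ) ℚ_[((Rat.HeightOneSpectrum.primesEquiv v₀ : Nat.Primes) : ℕ)]) ι
    rw [towerSignedLocalPointsOfEmb_comp, ← conjH1_mem_localKummerOverOfEmb_iff]
    rw [AddSubgroup.mem_iInf] at hy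
    exact hy _

end EtaLayer

/-! ## §3 The item `EtaLayerComparison` BY NAME -/

/-- **Item stmt-BirchSwinnertonDyer-19583 `EtaLayerComparison` (hLayer) — PROVED.** For every layer
`n`, the image of Kobayashi's plus Selmer group `Sel⁺(V_F/F_n)` (Γ_F-internal, Def. 1.1 conditions at
the places of `F_n`, plus condition at `𝔭 ∣ p` over `F_𝔭·F_n`) under ctrl's base-change isomorphism
`Θ_n = subgroupH1Iso ∘ res` is cc-typer-6's tower plus Selmer group `Sel⁺(V/Fℚ_n)` (Γ_ℚ-internal,
model `ℚ_p`): restriction along `Gal(F̄/F_n) = res⁻¹ Gal(ℚ̄/Fℚ_n)` (§1), then the classical parts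
(`EtaLayer.map_subgroupH1Iso_selmerGroupOver`) and the plus-Kummer parts
(`EtaLayer.map_subgroupH1Iso_plusKummerConditions`) correspond, `Θ_n` being injective. The
hypotheses `5 ≤ p`, good supersingular reduction, `κ` cyclotomic and `θ_F² = p*` of the item are not
used (the comparison is Galois-cohomology bookkeeping valid for every quadratic `F`); `[F : ℚ] = 2`
gives `F/ℚ` Galois. [cite: Kobayashi2003, Def. 1.1 (p. 2), Def. 2.1 (p. 5)] [cite: GreenbergLNM1716, §2] -/
theorem etaLayerComparison_proof :
    Summit.BirchSwinnertonDyer.BirchSwinnertonDyer.Theses.QuadraticBranchSignedControl.EtaLayerComparison := by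
  unfold Theses.QuadraticBranchSignedControl.EtaLayerComparison
  intro p _ _ V _ _ _ _ κ _ F _ _ _ θF h2 _ _ hκ₀ n
  haveI : Algebra.IsQuadraticExtension ℚ F := ⟨h2⟩
  haveI : IsGalois ℚ F := inferInstance
  rw [← AddSubgroup.map_map, EtaLayer.map_resOfLe_signedSelmerLayer_eq (V.baseChange F)
    (restrictGal F κ hκ₀) 1 n (layerSubgroup_restrictGal F κ hκ₀ n),
    AddSubgroup.map_inf _ _ (subgroupH1Iso F V p (towerSubgroup_le_galRange κ F n)).toAddMonoidHom
      (subgroupH1Iso F V p (towerSubgroup_le_galRange κ F n)).injective,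
    EtaLayer.map_subgroupH1Iso_selmerGroupOver F V p (towerSubgroup_le_galRange κ F n),
    EtaLayer.map_subgroupH1Iso_plusKummerConditions V κ F hκ₀ n]
  rfl

end Summit.BirchSwinnertonDyer.BirchSwinnertonDyer.Theorems

end
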